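import Summits.ResolutionOfSingularities.ResolutionOfSingularities.Theses.QuotientModels
import Summits.ResolutionOfSingularities.ResolutionOfSingularities.Theorems.QuotientModelsHessianLadder
import Summits.ResolutionOfSingularities.ResolutionOfSingularities.Theorems.RadicandIsolatedClasses
import HarnessLib

/-!
# QuotientModelsIsolatedRadicands — kernels of the decomp-res node «IsolatedRadicands» (lens-1 g6) BY NAME

Source HOME/decomp-res-lens-1/g6/IsolatedRadicands.lean (sha256 f78930fc…, 527 lines; critic's `lean check` rc 0 ·
0 sorry · 0 warnings · `srm4_iff` axioms standard), CRITIC-LEDGER row 43 (2026-08-30T06:37Z): CLEARED AS CHILD NODE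
of `QuotientModels:27201` (SRM₄), superseding HessianLadder rev 2 on (I) the split of the residual 28914 and (II) the
RE-TAG of 28912 (`HyperbolicRadicands` → DECIDED-MOD-PORT by the NEW LEMMA: parafactorial 𝔪-primary descent +
cA-dictionary driven by CJS Thm. 1.2, checked §A–§E line by line by the critic).

Pieces (route asides, QuotientModels rev 5): `TameRadicands` 28911 · `HyperbolicRadicands` 28912 · `RankOneRadicands`
28913 · `DegenerateRadicands` 28914 ⟺ `IsolatedDegenerateRadicands` 29578 [UNDECIDED(T-iso-formal), located
formal descent-free, costume-risk declared] ∧ `NonIsolatedRadicands` 29579 [declared residual, score 0 conceded, not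
absorbing]; supports refining 28912: `HyperbolicSplitting` 29580 (M), `MPrimaryReduction` 29581 (S, PROVABLE NOW),
`CompoundAResolution` 29582 (L), `ParafactorialDescent` 29583 (L).  Notions: `Theorems/RadicandIsolatedClasses.lean`
(`IsolatedClass`, …) over `Theorems/RadicandHessianClasses.lean`.

Kernels (0 sorry): `degenerateRadicands_iff` (28914 ⟺ 29578 ∧ 29579 — the glue of the split, PROVED by excluded
middle on `IsolatedClass`), `closes_degenerate`, `closes` (five rungs ⇒ SRM₄ 27201 BY NAME through the landed
`QuotientModelsHessianLadder.closes`), `isolatedDegenerateRadicands_of_srm4`, `nonIsolatedRadicands_of_srm4`,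
`srm4_iff` (5-way EXACT), `pieces_of_root` (every piece summit-implied).
Why this is novel: the residual of the Hessian-rank ladder is cut by the DIMENSION of the critical locus; at isolated
points the parafactoriality of 4-dimensional hypersurface rings (SGA 2 XI) makes every formal resolution descend along an
𝔪-primary blow-up — a descent tool for purely inseparable root covers not found in print.
[CossartPiltant2019 Rem. 3.2; CossartJannsenSaito2020 Thm. 1.2; hauser2024 p.2]
-/

namespace Summit.ResolutionOfSingularities.ResolutionOfSingularities.Theorems.QuotientModelsIsolatedRadicands

open AlgebraicGeometry Literature.AlgebraicGeometry.Resolution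
open Summit.ResolutionOfSingularities.ResolutionOfSingularities.Theses
open Summit.ResolutionOfSingularities.ResolutionOfSingularities.Theorems
open Summit.ResolutionOfSingularities.ResolutionOfSingularities.Theorems.RadicandHessianClasses
open Summit.ResolutionOfSingularities.ResolutionOfSingularities.Theorems.RadicandIsolatedClasses

/-! ## The split of the g5 residual is exact -/

/-- **The g6 split of the g5 residual is exact**: item 28914
`QuotientModels.DegenerateRadicands ⟺ IsolatedDegenerateRadicands (29578) ∧ NonIsolatedRadicands (29579)`. -/
theorem degenerateRadicands_iff :
    QuotientModels.DegenerateRadicands ↔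
      QuotientModels.IsolatedDegenerateRadicands ∧ QuotientModels.NonIsolatedRadicands := by
  constructor
  · intro h
    exact ⟨fun p hp k _ _ L K _ _ _ _ _ _ a ha htop hN M hM h₁ h₂ _ =>
        h p hp k L K a ha htop hN M hM h₁ h₂,
      fun p hp k _ _ L K _ _ _ _ _ _ a ha htop hN M hM h₁ h₂ _ =>
        h p hp k L K a ha htop hN M hM h₁ h₂⟩
  · rintro ⟨h₃, h₄⟩ p hp k _ _ L K _ _ _ _ _ _ a ha htop hN M hM h₁ h₂
    by_cases c : IsolatedClass p k L K
    · exact h₃ p hp k L K a ha htop hN M hM h₁ h₂ c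
    · exact h₄ p hp k L K a ha htop hN M hM h₁ h₂ c

/-- **closes (residual form)** — the two new pieces give item 28914 BY NAME. -/
theorem closes_degenerate (h₃ : QuotientModels.IsolatedDegenerateRadicands)
    (h₄ : QuotientModels.NonIsolatedRadicands) : QuotientModels.DegenerateRadicands :=
  degenerateRadicands_iff.mpr ⟨h₃, h₄⟩

/-! ## Deciding theorem and exactness -/

/-- **closes** — the five rungs give SRM₄ = `QuotientModels.SimpleRadicialRegModelDimFour` (item 27201) BY NAME,
through the landed g5 kernel `QuotientModelsHessianLadder.closes` on the items 28911 · 28912 · 28913 and the residual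
split above. -/
theorem closes (h₀ : QuotientModels.TameRadicands) (h₁ : QuotientModels.HyperbolicRadicands)
    (h₂ : QuotientModels.RankOneRadicands) (h₃ : QuotientModels.IsolatedDegenerateRadicands)
    (h₄ : QuotientModels.NonIsolatedRadicands) : QuotientModels.SimpleRadicialRegModelDimFour :=
  QuotientModelsHessianLadder.closes h₀ h₁ h₂ (closes_degenerate h₃ h₄)

/-- The isolated-degenerate rung is a restriction of SRM₄ (WEAKER, evidence). -/
theorem isolatedDegenerateRadicands_of_srm4 (h : QuotientModels.SimpleRadicialRegModelDimFour) :
    QuotientModels.IsolatedDegenerateRadicands :=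
  (degenerateRadicands_iff.mp (QuotientModelsHessianLadder.degenerateRadicands_of_srm4 h)).1

/-- The non-isolated residual is a restriction of SRM₄ (WEAKER, evidence). -/
theorem nonIsolatedRadicands_of_srm4 (h : QuotientModels.SimpleRadicialRegModelDimFour) :
    QuotientModels.NonIsolatedRadicands :=
  (degenerateRadicands_iff.mp (QuotientModelsHessianLadder.degenerateRadicands_of_srm4 h)).2

/-- **Exact kernel**: SRM₄ ⟺ the conjunction of the five rungs (nothing lost, nothing smuggled). -/
theorem srm4_iff :
    QuotientModels.SimpleRadicialRegModelDimFour ↔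
      QuotientModels.TameRadicands ∧ QuotientModels.HyperbolicRadicands ∧
        QuotientModels.RankOneRadicands ∧ QuotientModels.IsolatedDegenerateRadicands ∧
          QuotientModels.NonIsolatedRadicands :=
  ⟨fun h => ⟨QuotientModelsHessianLadder.tameRadicands_of_srm4 h,
      QuotientModelsHessianLadder.hyperbolicRadicands_of_srm4 h,
      QuotientModelsHessianLadder.rankOneRadicands_of_srm4 h,
      isolatedDegenerateRadicands_of_srm4 h, nonIsolatedRadicands_of_srm4 h⟩,
    fun h => closes h.1 h.2.1 h.2.2.1 h.2.2.2.1 h.2.2.2.2⟩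

/-- Every piece is summit-implied (no piece is stronger than the root). -/
theorem pieces_of_root (h : _root_.ResolutionOfSingularities) :
    QuotientModels.TameRadicands ∧ QuotientModels.HyperbolicRadicands ∧
      QuotientModels.RankOneRadicands ∧ QuotientModels.IsolatedDegenerateRadicands ∧
        QuotientModels.NonIsolatedRadicands :=
  srm4_iff.mp (QuotientModelsHessianLadder.srm4_of_root h)

/-- The two new rungs are summit-implied. -/
theorem newRungs_of_root (h : _root_.ResolutionOfSingularities) :
    QuotientModels.IsolatedDegenerateRadicands ∧ QuotientModels.NonIsolatedRadicands :=
  ⟨(pieces_of_root h).2.2.2.1, (pieces_of_root h).2.2.2.2⟩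

end Summit.ResolutionOfSingularities.ResolutionOfSingularities.Theorems.QuotientModelsIsolatedRadicands
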